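import Literature.Geometry.GeometricMeasureTheory.SlabCurrent
import Literature.Geometry.GeometricMeasureTheory.CurrentsPushforward

/-!
# Push-forward of the slab current: the homotopy current of a smooth family

For a smooth `Φ : ℝ × P → V` ("a smooth homotopy `Φ(t, ·)`"), a cutoff `χ ∈ 𝒟⁰(Ω)` on an open
`Ω ⊆ ℝ × P` and a constant `n`-frame `e` of `P`, the push-forward
`S = Φ_# (χ · ⟦0,1⟧ × (μ ∧ e))` of the slab current of `SlabCurrent.lean`
(`Current.pushforward` of `CurrentsPushforward.lean`) is the `(n+1)`-current on `Ω' ⊆ V`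

* `slabCurrent_pushforward_apply` :
  `S(φ) = ∫ χ(z) φ(Φ z)(DΦ(z)(1,0), DΦ(z)(0,e₁), …, DΦ(z)(0,eₙ)) d((vol ⌞ [0,1]) × μ)(z)`,

with the mass bound

* `mass_slabCurrent_pushforward_le` : `𝐌(S) ≤ ∫ |χ z| ∏ᵢ ‖DΦ(z) vᵢ‖ dz`,

and — when on the slab the cutoff is locally constant in `t`, and constant in `x` wherever `Φ`
is not stationary in `t` — **the homotopy formula** (Federer 4.1.8–4.1.9,
`∂ Φ_#(⟦0,1⟧ × T) = Φ(1,·)_# T − Φ(0,·)_# T − Φ_#(⟦0,1⟧ × ∂T)` with `∂(μ ∧ e) = 0`):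

* `slabCurrent_pushforward_boundary_apply` :
  `∂S(φ) = ∫_P χ(1,x) φ(Φ(1,x))(D Φ(1,x)(0,eⱼ))ⱼ dμ − ∫_P χ(0,x) φ(Φ(0,x))(D Φ(0,x)(0,eⱼ))ⱼ dμ`.

The proof of the last combines `∂(slab) = top − bottom` (`slabCurrent_boundary_apply`) with
`d(χ · Φ^*φ) = χ · Φ^*(dφ) + dχ ∧ Φ^*φ` (Mathlib's `extDeriv_pullback`, `fderiv_smul`), the
wedge term vanishing on the slab under the two hypotheses on `χ`.

## References

* H. Federer, *Geometric Measure Theory*, Springer 1969, 4.1.7–4.1.9 [Federer1969].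
-/

noncomputable section

open scoped Topology ENNReal NNReal Distributions ContDiff
open MeasureTheory TopologicalSpace Set Filter

namespace Literature.Geometry.GeometricMeasureTheory

-- Nested operator-norm instances on (duals of) `E [⋀^Fin m]→L[ℝ] ℝ`.
set_option maxSynthPendingDepth 2

variable {P : Type*} [NormedAddCommGroup P] [NormedSpace ℝ P] [FiniteDimensional ℝ P]
  [MeasurableSpace P] [BorelSpace P] (μ : Measure P) [μ.IsAddHaarMeasure]
  {V : Type*} [NormedAddCommGroup V] [NormedSpace ℝ V]
  {Ω : Opens (ℝ × P)} {Ω' : Opens V} {n : ℕ}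

/-- **The homotopy current** `S = Φ_#(χ · ⟦0,1⟧ × (μ ∧ e))`:
`S(φ) = ∫ χ z · φ(Φ z)(DΦ(z) v₀, …, DΦ(z) vₙ) d((vol ⌞ [0,1]) × μ)`. [cite: Federer1969, 4.1.7–4.1.9] -/
theorem slabCurrent_pushforward_apply (e : Fin n → P) (χ : 𝓓(Ω, ℝ)) {Φ : ℝ × P → V}
    (hΦ : ContDiff ℝ ∞ Φ) (φ : TestForm Ω' (n + 1)) :
    (slabCurrent μ Ω e).pushforward Ω' χ hΦ φ =
      ∫ z, χ z * φ (Φ z) (fun i => fderiv ℝ Φ z (slabFrame e i))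
        ∂(((volume : Measure ℝ).restrict (Icc 0 1)).prod μ) := by
  rw [Current.pushforward_apply, slabCurrent_apply]
  congr 1

omit [MeasurableSpace P] [BorelSpace P] [FiniteDimensional ℝ P] in
/-- `|φ(y)(w₀, …, wₙ)| ≤ ‖φ y‖ ∏ ‖wᵢ‖`. [folklore] -/
theorem abs_apply_frame_le (φ : V → Covector V (n + 1)) (y : V) (w : Fin (n + 1) → V) :
    |φ y w| ≤ ‖φ y‖ * ∏ i, ‖w i‖ := by
  rw [← Real.norm_eq_abs]
  exact (φ y).le_opNorm w

/-- **Mass of the homotopy current**: `𝐌(S) ≤ ∫ |χ z| ∏ᵢ ‖DΦ(z) vᵢ‖ d((vol ⌞ [0,1]) × μ)`.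
[cite: Federer1969, 4.1.9] -/
theorem mass_slabCurrent_pushforward_le (e : Fin n → P) (χ : 𝓓(Ω, ℝ)) {Φ : ℝ × P → V}
    (hΦ : ContDiff ℝ ∞ Φ) :
    ((slabCurrent μ Ω e).pushforward Ω' χ hΦ : Current Ω' (n + 1)).mass ≤
      ENNReal.ofReal (∫ z, |χ z| * ∏ i, ‖fderiv ℝ Φ z (slabFrame e i)‖
        ∂(((volume : Measure ℝ).restrict (Icc 0 1)).prod μ)) := by
  set ν : Measure (ℝ × P) := ((volume : Measure ℝ).restrict (Icc 0 1)).prod μ with hν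
  have hνle : ν ≤ (volume : Measure ℝ).prod μ := Measure.prod_mono Measure.restrict_le_self le_rfl
  -- the bound is a continuous compactly supported function, hence integrable
  have hbc : Continuous fun z : ℝ × P => |χ z| * ∏ i, ‖fderiv ℝ Φ z (slabFrame e i)‖ :=
    (continuous_abs.comp χ.continuous).mul (continuous_finsetProd _ fun i _ =>
      ((hΦ.continuous_fderiv (by simp)).clm_apply continuous_const).norm)
  have hbs : HasCompactSupport fun z : ℝ × P => |χ z| * ∏ i, ‖fderiv ℝ Φ z (slabFrame e i)‖ := by
    have h1 : HasCompactSupport fun z : ℝ × P => |χ z| := by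
      simpa [← Real.norm_eq_abs] using χ.hasCompactSupport.norm
    exact h1.mul_right
  have hbi : Integrable (fun z : ℝ × P => |χ z| * ∏ i, ‖fderiv ℝ Φ z (slabFrame e i)‖) ν :=
    (hbc.integrable_of_hasCompactSupport hbs).mono_measure hνle
  refine iSup₂_le fun φ hφ => ?_
  rw [slabCurrent_pushforward_apply]
  refine ENNReal.ofReal_le_ofReal ?_
  refine (le_abs_self _).trans ((abs_integral_le_integral_abs).trans ?_)
  refine integral_mono_of_nonneg (Eventually.of_forall fun z => abs_nonneg _) hbi
    (Eventually.of_forall fun z => ?_)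
  simp only
  rw [abs_mul]
  refine mul_le_mul_of_nonneg_left ?_ (abs_nonneg _)
  calc |φ (Φ z) fun i => fderiv ℝ Φ z (slabFrame e i)|
      ≤ ‖φ (Φ z)‖ * ∏ i, ‖fderiv ℝ Φ z (slabFrame e i)‖ := abs_apply_frame_le _ _ _
    _ ≤ 1 * ∏ i, ‖fderiv ℝ Φ z (slabFrame e i)‖ :=
        mul_le_mul_of_nonneg_right (hφ (Φ z)) (Finset.prod_nonneg fun i _ => norm_nonneg _)
    _ = ∏ i, ‖fderiv ℝ Φ z (slabFrame e i)‖ := one_mul _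

/-! ### The homotopy formula -/

omit [MeasurableSpace P] [BorelSpace P] [FiniteDimensional ℝ P] in
/-- Product rule for the exterior derivative of `χ • η` against a frame:
`d(χ η)(z)(v) = χ z · dη(z)(v) + Σᵢ (-1)ⁱ Dχ(z)(vᵢ) · η(z)(v̂ᵢ)`. [folklore] -/
theorem extDeriv_smul_apply_eq {m : ℕ} {χ : ℝ × P → ℝ} {η : ℝ × P → Covector (ℝ × P) m}
    {z : ℝ × P} (hχ : DifferentiableAt ℝ χ z) (hη : DifferentiableAt ℝ η z)
    (v : Fin (m + 1) → ℝ × P) :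
    extDeriv (fun y => χ y • η y) z v =
      χ z * extDeriv η z v +
        ∑ i : Fin (m + 1), ((-1 : ℝ) ^ (i : ℕ)) * (fderiv ℝ χ z (v i) * η z (i.removeNth v)) := by
  have hd : DifferentiableAt ℝ (fun y => χ y • η y) z := hχ.smul hη
  rw [extDeriv_apply hd, extDeriv_apply hη]
  simp_rw [← Int.cast_smul_eq_zsmul ℝ, Int.cast_pow, Int.cast_neg, Int.cast_one]
  have hslice : ∀ i : Fin (m + 1),
      fderiv ℝ (fun x => (χ x • η x) (i.removeNth v)) z (v i) =
        χ z * fderiv ℝ (fun x => η x (i.removeNth v)) z (v i) +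
          fderiv ℝ χ z (v i) * η z (i.removeNth v) := by
    intro i
    have hηi : DifferentiableAt ℝ (fun x => η x (i.removeNth v)) z :=
      (ContinuousAlternatingMap.apply ℝ (ℝ × P) ℝ (i.removeNth v)).differentiableAt.comp z hη
    have hfun : (fun x => (χ x • η x) (i.removeNth v)) = fun x => χ x * η x (i.removeNth v) := by
      funext x
      rfl
    rw [hfun, fderiv_fun_mul hχ hηi]
    simp only [_root_.add_apply, FunLike.coe_smul, Pi.smul_apply, smul_eq_mul]
    ring
  simp_rw [hslice]
  rw [Finset.mul_sum, ← Finset.sum_add_distrib]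
  refine Finset.sum_congr rfl fun i _ => ?_
  rw [smul_eq_mul, smul_eq_mul]
  ring

omit [MeasurableSpace P] [BorelSpace P] [FiniteDimensional ℝ P] in
/-- A covector vanishes on a frame `A ∘ v̂_{j+1}` whenever `A` kills `v₀` (the face `v̂_{j+1}`
still contains `v₀`). [folklore] -/
theorem apply_removeNth_succ_eq_zero {m : ℕ} (ψ : Covector V m) (A : ℝ × P →L[ℝ] V)
    (v : Fin (m + 1) → ℝ × P) (h0 : A (v 0) = 0) (j : Fin m) :
    ψ (fun k => A (j.succ.removeNth v k)) = 0 := by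
  cases m with
  | zero => exact j.elim0
  | succ m' =>
    refine ψ.map_coord_zero (0 : Fin (m' + 1)) ?_
    show A (v (j.succ.succAbove 0)) = 0
    rw [Fin.succAbove_ne_zero_zero (Fin.succ_ne_zero j)]
    exact h0

/-- **The homotopy formula** `∂ Φ_#(⟦0,1⟧ × (μ ∧ e)) = Φ(1,·)_#(μ ∧ e) − Φ(0,·)_#(μ ∧ e)`:
if on the slab `[0,1] × P` the cutoff `χ` has no `t`-derivative, and at each slab point either
`χ` has no `x`-derivative or `Φ` is stationary in `t`, then for every test `n`-form `φ` on `Ω'`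
`∂S(φ) = ∫_P χ(1,x) φ(Φ(1,x))(DΦ(1,x)(0,eⱼ))ⱼ dμ − ∫_P χ(0,x) φ(Φ(0,x))(DΦ(0,x)(0,eⱼ))ⱼ dμ`.
[cite: Federer1969, 4.1.8–4.1.9] -/
theorem slabCurrent_pushforward_boundary_apply (e : Fin n → P) (χ : 𝓓(Ω, ℝ)) {Φ : ℝ × P → V}
    (hΦ : ContDiff ℝ ∞ Φ)
    (ht : ∀ z : ℝ × P, z.1 ∈ Icc (0 : ℝ) 1 → fderiv ℝ (χ : ℝ × P → ℝ) z ((1 : ℝ), (0 : P)) = 0)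
    (hx : ∀ z : ℝ × P, z.1 ∈ Icc (0 : ℝ) 1 →
      (∀ w : P, fderiv ℝ (χ : ℝ × P → ℝ) z ((0 : ℝ), w) = 0) ∨
        fderiv ℝ Φ z ((1 : ℝ), (0 : P)) = 0)
    (φ : TestForm Ω' n) :
    ((slabCurrent μ Ω e).pushforward Ω' χ hΦ).boundary φ =
      (∫ x, χ ((1 : ℝ), x) * φ (Φ ((1 : ℝ), x))
          (fun j => fderiv ℝ Φ ((1 : ℝ), x) ((0 : ℝ), e j)) ∂μ) -
        ∫ x, χ ((0 : ℝ), x) * φ (Φ ((0 : ℝ), x))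
          (fun j => fderiv ℝ Φ ((0 : ℝ), x) ((0 : ℝ), e j)) ∂μ := by
  set v := slabFrame e with hv
  set ν : Measure (ℝ × P) := ((volume : Measure ℝ).restrict (Icc 0 1)).prod μ with hν
  -- the raw pull-back `η = Φ^* φ` and the cut-off one `χ • η`
  set η : ℝ × P → Covector (ℝ × P) n := fun y =>
    (φ (Φ y)).compContinuousLinearMap (fderiv ℝ Φ y) with hη
  have hηd : ContDiff ℝ ∞ η :=
    (contDiff_compContinuousLinearMapCLM_fderiv hΦ).clm_apply (φ.contDiff.comp hΦ)
  have hηdiff : ∀ z, DifferentiableAt ℝ η z := fun z =>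
    (hηd.differentiable (by simp)).differentiableAt
  have hχdiff : ∀ z, DifferentiableAt ℝ (χ : ℝ × P → ℝ) z := fun z =>
    (χ.contDiff.differentiable (by simp)).differentiableAt
  have hpb : ∀ ψ' : TestForm Ω' n, ⇑(TestForm.pullback χ hΦ ψ') =
      fun y => χ y • (ψ' (Φ y)).compContinuousLinearMap (fderiv ℝ Φ y) := fun ψ' =>
    funext fun y => TestForm.pullback_apply χ hΦ ψ' y
  -- top − bottom for the cut-off pull-back
  have hA := slabCurrent_boundary_apply μ Ω e (TestForm.pullback χ hΦ φ)
  rw [Current.boundary_apply] at hA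
  have hA' : ∀ t : ℝ, (∫ x, TestForm.pullback χ hΦ φ (t, x) (fun j => ((0 : ℝ), e j)) ∂μ) =
      ∫ x, χ (t, x) * φ (Φ (t, x)) (fun j => fderiv ℝ Φ (t, x) ((0 : ℝ), e j)) ∂μ := by
    intro t
    congr 1
  rw [hA' 1, hA' 0] at hA
  rw [← hA, Current.boundary_apply, Current.pushforward_apply, ← sub_eq_zero, ← map_sub,
    slabCurrent_apply]
  -- the integrand vanishes on the slab
  have hzero : ∀ z : ℝ × P, z.1 ∈ Icc (0 : ℝ) 1 →
      (TestForm.pullback χ hΦ (TestForm.extDerivCLM φ) -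
        TestForm.extDerivCLM (TestForm.pullback χ hΦ φ)) z v = 0 := by
    intro z hz
    have e1 : (TestForm.pullback χ hΦ (TestForm.extDerivCLM φ) -
        TestForm.extDerivCLM (TestForm.pullback χ hΦ φ)) z v =
        TestForm.pullback χ hΦ (TestForm.extDerivCLM φ) z v -
          extDeriv ⇑(TestForm.pullback χ hΦ φ) z v := by
      rw [← congrFun (TestForm.extDerivCLM_apply (TestForm.pullback χ hΦ φ)) z]
      rfl
    rw [e1, hpb φ, extDeriv_smul_apply_eq (hχdiff z) (hηdiff z), TestForm.pullback_apply,
      TestForm.extDerivCLM_apply]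
    -- `d(Φ^*φ) = Φ^*(dφ)`
    have e2 : extDeriv η z = (extDeriv ⇑φ (Φ z)).compContinuousLinearMap (fderiv ℝ Φ z) :=
      extDeriv_pullback (φ.contDiff.differentiable (by simp)).differentiableAt hΦ.contDiffAt
        (by rw [minSmoothness_of_isRCLikeNormedField]; exact WithTop.coe_le_coe.2 le_top)
    rw [e2]
    simp only [ContinuousAlternatingMap.smul_apply, smul_eq_mul, sub_add_cancel_left,
      neg_eq_zero]
    -- the wedge term vanishes
    rw [Fin.sum_univ_succ]
    have h0 : fderiv ℝ (χ : ℝ × P → ℝ) z (v 0) = 0 := by rw [hv, slabFrame_zero]; exact ht z hz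
    rw [h0, zero_mul, mul_zero, zero_add]
    refine Finset.sum_eq_zero fun j _ => ?_
    rcases hx z hz with h | h
    · rw [hv, slabFrame_succ, h (e j), zero_mul, mul_zero]
    · have : η z (j.succ.removeNth v) = 0 := by
        simp only [hη, ContinuousAlternatingMap.compContinuousLinearMap_apply]
        refine apply_removeNth_succ_eq_zero (φ (Φ z)) (fderiv ℝ Φ z) v ?_ j
        rw [hv, slabFrame_zero]
        exact h
      rw [this, mul_zero, mul_zero]
  refine integral_eq_zero_of_ae ?_
  have hae : ∀ᵐ z ∂ν, z.1 ∈ Icc (0 : ℝ) 1 := by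
    have h1 : ∀ᵐ t ∂((volume : Measure ℝ).restrict (Icc 0 1)), t ∈ Icc (0 : ℝ) 1 :=
      ae_restrict_mem measurableSet_Icc
    exact (Measure.quasiMeasurePreserving_fst (μ := (volume : Measure ℝ).restrict (Icc 0 1))
      (ν := μ)).ae h1
  filter_upwards [hae] with z hz
  exact hzero z hz

end Literature.Geometry.GeometricMeasureTheory
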